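import Summits.ValiantsHypothesis.ValiantsHypothesis.Theorems.SymmetroidPencilBasics
import Summits.ValiantsHypothesis.ValiantsHypothesis.Theses.SymmetroidDescartes

/-!
# ValiantsHypothesis / SymmetroidDescartes — the glue `RolleToDescartes`

Route `SymmetroidDescartes`, item `stmt-ValiantsHypothesis-18503` (support, rank 9):
`RolleToDescartes : DerivedPencilRolle → LacunaryDescartes` — the inductive step on the number of
terms implies the lacunary matrix Descartes rule.

Proof.
1. Sign alternations of a real polynomial at strictly increasing positive test points give as many
   distinct positive roots (intermediate value theorem on each gap) — `le_card_posRoots_of_alternating`.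
2. `DerivedPencilRolle` iterated `K` times: an invertible-coefficient strictly lacunary symmetric
   `(K+1)`-term pencil has at most `(K+1)·C'^K·(m+K)^a` distinct positive roots, `C' = max C 1`; the
   base case is the `K = 0` instance of the hypothesis (the empty derived pencil has no positive
   roots) — `posRoots_le_of_derivedPencilRolle`.
3. An arbitrary symmetric `K`-term pencil is MERGED (equal exponents collected and sorted; the
   evaluated matrix is unchanged) and PERTURBED (`U ↦ U + η • 1` with `η > 0` small and off the
   finitely many roots of the characteristic polynomials `charpoly (-U)`), which keeps the signs of the
   determinant at the `N+1` test points (continuity of `det` in `η`) and makes every coefficient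
   invertible; hence `N ≤ K·C'^K·(m+K)^a` — `alternations_le_of_derivedPencilRolle`.
4. Regime arithmetic: for `K ≥ 2^(max 6 (a(c+2)))` and `m ≤ 2^(c(log₂K+1)²)` one has
   `(m+K)^a ≤ K^K`, so `K·C'^K·(m+K)^a ≤ K^((C'+2)K)` and `b := C' + 2` works — `regime_pow_le`.

Sources: the Descartes / Pólya–Szegő induction on the number of monomials (Khovanskiĭ 1991,
*Fewnomials* §1.1; Koiran–Portier–Tavenas, arXiv:1205.1015 §2, Lemmas 1–2); the genericity
perturbation is elementary linear algebra. No named facts are used: the result is unconditional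
(relative to its hypothesis `DerivedPencilRolle`, which is the route's crux).
-/

-- `Summit.ValiantsHypothesis.ValiantsHypothesis.…` is the tree's mandated single-conjunct layout
-- (Sub = Summit), so the duplicated namespace component is intended.
set_option linter.dupNamespace false

namespace Summit.ValiantsHypothesis.ValiantsHypothesis.Theses.SymmetroidDescartes
/-- **Record of the DROPPED route item `DerivedPencilRolle`** (stmt-18500, ledger signature verbatim, original FQN;
FALSE: `…not_DerivedPencilRolle`; NOT a route item).  Dropped with `RolleToDescartes` by the route repair of 08-17T08:30Z
while this append-only file and its importers still name them; re-declared only so that they keep elaborating. -/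
def DerivedPencilRolle : Prop :=
  ∃ C a : ℕ, ∀ (m K : ℕ) (S : Fin (K + 1) → Matrix (Fin m) (Fin m) ℝ) (d : Fin (K + 1) → ℕ), (∀ l, (S l).IsSymm) → (∀ l, (S l).det ≠ 0) → StrictMono d → ((∑ l, (Polynomial.X : Polynomial ℝ) ^ d l • (S l).map Polynomial.C).det.roots.toFinset.filter (fun t => 0 < t)).card ≤ C * ((∑ l : Fin K, (Polynomial.X : Polynomial ℝ) ^ (d l.succ - d 0 - 1) • (((d l.succ - d 0 : ℕ) : ℝ) • S l.succ).map Polynomial.C).det.roots.toFinset.filter (fun t => 0 < t)).card + (m + K) ^ a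
/-- **Record of the DROPPED route item `RolleToDescartes`** (stmt-18503, verbatim; NOT a route item; proved below). -/
def RolleToDescartes : Prop := DerivedPencilRolle → LacunaryDescartes
end Summit.ValiantsHypothesis.ValiantsHypothesis.Theses.SymmetroidDescartes
namespace Summit.ValiantsHypothesis.ValiantsHypothesis.Theorems.SymmetroidDescartes

open scoped BigOperators Topology Classical Matrix Polynomial
open Filter

open Summit.ValiantsHypothesis.ValiantsHypothesis.Theses.SymmetroidDescartes

/-! ### 3. Iterating the inductive step -/

/-- `K`-fold iteration of the inductive step `DerivedPencilRolle`: there are `C ≥ 1` and `a` such that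
every `(K+1)`-term pencil `∑ X^(d l) • S l` with real symmetric invertible coefficients and strictly
increasing exponents has at most `(K+1)·C^K·(m+K)^a` distinct positive roots of its determinant.
Induction on `K`; the base case is the `K = 0` instance of the hypothesis (the derived pencil is
empty). [folklore] -/
theorem posRoots_le_of_derivedPencilRolle (h : DerivedPencilRolle) :
    ∃ C a : ℕ, 1 ≤ C ∧ ∀ (K m : ℕ) (S : Fin (K + 1) → Matrix (Fin m) (Fin m) ℝ)
      (d : Fin (K + 1) → ℕ), (∀ l, (S l).IsSymm) → (∀ l, (S l).det ≠ 0) → StrictMono d →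
      ((∑ l, (Polynomial.X : ℝ[X]) ^ d l • (S l).map Polynomial.C).det.roots.toFinset.filter
        (fun t => 0 < t)).card ≤ (K + 1) * C ^ K * (m + K) ^ a := by
  obtain ⟨C, a, hR⟩ := h
  refine ⟨max C 1, a, le_max_right _ _, ?_⟩
  intro K
  induction K with
  | zero =>
    intro m S d hS hdet hd
    have h0 := hR m 0 S d hS hdet hd
    rw [card_filter_roots_det_sum_fin_zero] at h0
    simpa using h0
  | succ K ih =>
    intro m S d hS hdet hd
    have h1 := hR m (K + 1) S d hS hdet hd
    have h0d : ∀ l : Fin (K + 1), d 0 < d l.succ := fun l => hd (Fin.succ_pos l)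
    have ih' := ih m (fun l => ((d l.succ - d 0 : ℕ) : ℝ) • S l.succ) (fun l => d l.succ - d 0 - 1)
      (fun l => (hS l.succ).smul _)
      (fun l => by
        rw [Matrix.det_smul]
        refine mul_ne_zero (pow_ne_zero _ ?_) (hdet l.succ)
        have := h0d l
        exact_mod_cast (show (d l.succ - d 0 : ℕ) ≠ 0 by omega))
      (fun i j hij => by
        have h1 := hd (Fin.succ_lt_succ_iff.2 hij)
        have h2 := h0d i
        show d i.succ - d 0 - 1 < d j.succ - d 0 - 1
        omega)
    calc _ ≤ C * _ + (m + (K + 1)) ^ a := h1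
      _ ≤ max C 1 * ((K + 1) * max C 1 ^ K * (m + (K + 1)) ^ a)
          + max C 1 ^ (K + 1) * (m + (K + 1)) ^ a := by
        refine Nat.add_le_add (Nat.mul_le_mul (le_max_left _ _) (ih'.trans ?_))
          (Nat.le_mul_of_pos_left _ (by positivity))
        gcongr
        omega
      _ = (K + 1 + 1) * max C 1 ^ (K + 1) * (m + (K + 1)) ^ a := by ring

/-! ### 4. Merging and perturbation -/

/-- For an ARBITRARY real symmetric `K`-term lacunary pencil (repeated exponents and singular
coefficients allowed), the number `N` of strict sign alternations of its determinant along a strictly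
increasing positive sequence of test points is at most `K·C^K·(m+K)^a`, with the constants of
`posRoots_le_of_derivedPencilRolle`.  Merge equal exponents, perturb the coefficients by `η • 1`
(`η > 0` small, off the spectra), count roots between test points. [folklore] -/
theorem alternations_le_of_derivedPencilRolle (h : DerivedPencilRolle) :
    ∃ C a : ℕ, 1 ≤ C ∧ ∀ (K m : ℕ) (S : Fin K → Matrix (Fin m) (Fin m) ℝ) (d : Fin K → ℕ),
      (∀ l, (S l).IsSymm) → ∀ (N : ℕ) (τ : Fin (N + 1) → ℝ), StrictMono τ → (∀ j, 0 < τ j) →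
      (∀ j : Fin N,
        ((∑ l, (Polynomial.X : ℝ[X]) ^ d l • (S l).map Polynomial.C).det).eval (τ j.castSucc) *
        ((∑ l, (Polynomial.X : ℝ[X]) ^ d l • (S l).map Polynomial.C).det).eval (τ j.succ) < 0) →
      N ≤ K * C ^ K * (m + K) ^ a := by
  obtain ⟨C, a, hC, hiter⟩ := posRoots_le_of_derivedPencilRolle h
  refine ⟨C, a, hC, ?_⟩
  intro K m S d hS N τ hτ hpos halt
  rcases Nat.eq_zero_or_pos N with hN | hN
  · simp [hN]
  have heval : ∀ t, ((∑ l, (Polynomial.X : ℝ[X]) ^ d l • (S l).map Polynomial.C).det).eval t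
      = (∑ l, t ^ d l • S l).det := eval_det_pencil S d
  -- `K > 0`: an empty pencil has a constant determinant, which cannot alternate.
  have hK : 0 < K := by
    rcases Nat.eq_zero_or_pos K with hK | hK
    · exfalso
      subst hK
      have h0 := halt ⟨0, hN⟩
      rw [heval, heval] at h0
      simp only [Finset.univ_eq_empty, Finset.sum_empty] at h0
      exact absurd h0 (not_lt.2 (mul_self_nonneg _))
    · exact hK
  -- (a) merge equal exponents: `k + 1` distinct exponents, enumerated increasingly by `e`.
  have hEpos : 0 < (Finset.univ.image d).card := by
    haveI : Nonempty (Fin K) := Fin.pos_iff_nonempty.1 hK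
    exact Finset.card_pos.2 (Finset.univ_nonempty.image d)
  obtain ⟨k, hk⟩ : ∃ k, (Finset.univ.image d).card = k + 1 := ⟨_, (Nat.succ_pred_eq_of_pos hEpos).symm⟩
  have hkK : k + 1 ≤ K := by
    rw [← hk]
    exact Finset.card_image_le.trans (by simp)
  obtain ⟨e, himg⟩ : ∃ e : Fin (k + 1) ↪o ℕ, Finset.univ.image e = Finset.univ.image d :=
    ⟨_, Finset.image_orderEmbOfFin_univ _ hk⟩
  obtain ⟨U, hU⟩ : ∃ U : ℕ → Matrix (Fin m) (Fin m) ℝ,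
      ∀ n, U n = ∑ l ∈ Finset.univ.filter (fun l => d l = n), S l := ⟨_, fun _ => rfl⟩
  have hUsymm : ∀ n, (U n).IsSymm := by
    intro n
    rw [hU]
    exact Finset.sum_induction _ Matrix.IsSymm (fun _ _ ha hb => ha.add hb) Matrix.isSymm_zero
      (fun l _ => hS l)
  have hmerge : ∀ t : ℝ, ∑ i : Fin (k + 1), t ^ (e i) • U (e i) = ∑ l, t ^ d l • S l := by
    intro t
    calc ∑ i : Fin (k + 1), t ^ (e i) • U (e i)
        = ∑ n ∈ Finset.univ.image e, t ^ n • U n := by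
          rw [Finset.sum_image fun x _ y _ hxy => e.injective hxy]
      _ = ∑ n ∈ Finset.univ.image d, ∑ l ∈ Finset.univ.filter (fun l => d l = n), t ^ d l • S l := by
          rw [himg]
          refine Finset.sum_congr rfl fun n _ => ?_
          rw [hU, Finset.smul_sum]
          refine Finset.sum_congr rfl fun l hl => ?_
          rw [(Finset.mem_filter.1 hl).2]
      _ = ∑ l, t ^ d l • S l :=
          Finset.sum_fiberwise_of_maps_to (fun l _ => Finset.mem_image_of_mem d (Finset.mem_univ l)) _
  -- (b) perturb: `f η t` is the determinant of the perturbed merged pencil at `t`.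
  obtain ⟨f, hf⟩ : ∃ f : ℝ → ℝ → ℝ, ∀ η t, f η t =
      (∑ i : Fin (k + 1), t ^ (e i) • (U (e i) + η • (1 : Matrix (Fin m) (Fin m) ℝ))).det :=
    ⟨_, fun _ _ => rfl⟩
  have hf0 : ∀ t, f 0 t
      = ((∑ l, (Polynomial.X : ℝ[X]) ^ d l • (S l).map Polynomial.C).det).eval t := by
    intro t
    simp only [hf, zero_smul, add_zero, hmerge, heval]
  have hfcont : ∀ t, Continuous fun η => f η t := by
    intro t
    simp only [hf]
    have hci : ∀ i : Fin (k + 1), Continuous fun η : ℝ =>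
        t ^ (e i) • (U (e i) + η • (1 : Matrix (Fin m) (Fin m) ℝ)) := fun i =>
      ((continuous_const : Continuous fun _ : ℝ => U (e i)).add
        (continuous_id.smul (continuous_const : Continuous fun _ : ℝ =>
          (1 : Matrix (Fin m) (Fin m) ℝ)))).const_smul (t ^ (e i))
    exact Continuous.matrix_det (continuous_finsetSum _ fun i _ => hci i)
  -- the determinant does not vanish at the test points
  have hf0ne : ∀ j : Fin (N + 1), f 0 (τ j) ≠ 0 := by
    intro j
    rw [hf0]
    by_cases hj : (j : ℕ) < N
    · have h1 := halt ⟨j, hj⟩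
      have hj' : (⟨j, hj⟩ : Fin N).castSucc = j := Fin.ext rfl
      rw [hj'] at h1
      intro h0
      rw [h0, zero_mul] at h1
      exact lt_irrefl _ h1
    · have hjN : (j : ℕ) = N := by omega
      have h1 := halt ⟨N - 1, by omega⟩
      have hj' : (⟨N - 1, by omega⟩ : Fin N).succ = j := Fin.ext (by simp only [Fin.val_succ]; omega)
      rw [hj'] at h1
      intro h0
      rw [h0, mul_zero] at h1
      exact lt_irrefl _ h1
  -- signs at the test points are preserved for `η` near `0`
  have hsign : ∀ᶠ η in 𝓝 (0 : ℝ), ∀ j : Fin (N + 1), 0 < f η (τ j) * f 0 (τ j) := by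
    refine Filter.eventually_all.2 fun j => ?_
    have h0 : 0 < f 0 (τ j) * f 0 (τ j) := mul_self_pos.2 (hf0ne j)
    exact (((hfcont (τ j)).mul continuous_const).tendsto 0).eventually (lt_mem_nhds h0)
  obtain ⟨ε, hε, hεsign⟩ := Metric.eventually_nhds_iff.1 hsign
  -- the perturbed coefficients are invertible off a finite set of `η`
  have hcharpoly : ∀ (n : ℕ) (η : ℝ),
      (-(U n)).charpoly.eval η = (U n + η • (1 : Matrix (Fin m) (Fin m) ℝ)).det := by
    intro n η
    rw [Matrix.charpoly, ← Polynomial.coe_evalRingHom, RingHom.map_det]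
    congr 1
    ext i j
    by_cases hij : i = j
    · subst hij
      simp [add_comm]
    · simp [hij]
  have hbad : {η : ℝ | ∃ i : Fin (k + 1),
      (U (e i) + η • (1 : Matrix (Fin m) (Fin m) ℝ)).det = 0}.Finite := by
    refine (Set.finite_iUnion fun i : Fin (k + 1) =>
      Polynomial.finite_setOf_isRoot (Matrix.charpoly_monic (-(U (e i)))).ne_zero).subset ?_
    rintro η ⟨i, hi⟩
    exact Set.mem_iUnion.2 ⟨i, by simp only [Set.mem_setOf_eq, Polynomial.IsRoot.def, hcharpoly, hi]⟩
  obtain ⟨η, ⟨hη0, hηε⟩, hηbad⟩ := ((Set.Ioo_infinite hε).sdiff hbad).nonempty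
  have hηdet : ∀ i : Fin (k + 1), (U (e i) + η • (1 : Matrix (Fin m) (Fin m) ℝ)).det ≠ 0 :=
    fun i hi => hηbad ⟨i, hi⟩
  have hηsign : ∀ j : Fin (N + 1), 0 < f η (τ j) * f 0 (τ j) :=
    hεsign (by rw [Real.dist_eq, sub_zero, abs_lt]; constructor <;> linarith)
  -- (c) the perturbed merged pencil: invertible symmetric coefficients, sorted distinct exponents
  obtain ⟨S', hS'⟩ : ∃ S' : Fin (k + 1) → Matrix (Fin m) (Fin m) ℝ,
      ∀ i, S' i = U (e i) + η • (1 : Matrix (Fin m) (Fin m) ℝ) := ⟨_, fun _ => rfl⟩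
  obtain ⟨d', hd'⟩ : ∃ d' : Fin (k + 1) → ℕ, ∀ i, d' i = e i := ⟨_, fun _ => rfl⟩
  have heval' : ∀ t, ((∑ i, (Polynomial.X : ℝ[X]) ^ d' i • (S' i).map Polynomial.C).det).eval t
      = f η t := by
    intro t
    rw [eval_det_pencil, hf]
    simp only [hS', hd']
  have halt' : ∀ j : Fin N,
      ((∑ i, (Polynomial.X : ℝ[X]) ^ d' i • (S' i).map Polynomial.C).det).eval (τ j.castSucc) *
      ((∑ i, (Polynomial.X : ℝ[X]) ^ d' i • (S' i).map Polynomial.C).det).eval (τ j.succ) < 0 := by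
    intro j
    rw [heval', heval']
    have h1 := hηsign j.castSucc
    have h2 := hηsign j.succ
    have h3 := halt j
    rw [← hf0, ← hf0] at h3
    by_contra hcon
    have hcon : 0 ≤ f η (τ j.castSucc) * f η (τ j.succ) := not_lt.1 hcon
    have h4 : 0 < (f η (τ j.castSucc) * f η (τ j.succ)) * (f 0 (τ j.castSucc) * f 0 (τ j.succ)) := by
      have := mul_pos h1 h2
      linarith [show (f η (τ j.castSucc) * f 0 (τ j.castSucc)) * (f η (τ j.succ) * f 0 (τ j.succ))
        = (f η (τ j.castSucc) * f η (τ j.succ)) * (f 0 (τ j.castSucc) * f 0 (τ j.succ)) by ring]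
    have h5 : (f η (τ j.castSucc) * f η (τ j.succ)) * (f 0 (τ j.castSucc) * f 0 (τ j.succ)) ≤ 0 :=
      mul_nonpos_of_nonneg_of_nonpos hcon h3.le
    linarith
  have hN' := le_card_posRoots_of_alternating _ N τ hτ hpos halt'
  have hZ := hiter k m S' d' (fun i => by rw [hS']; exact (hUsymm _).add (Matrix.isSymm_one.smul η))
    (fun i => by rw [hS']; exact hηdet i) (fun i j hij => by rw [hd', hd']; exact e.strictMono hij)
  calc N ≤ _ := hN'
    _ ≤ (k + 1) * C ^ k * (m + k) ^ a := hZ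
    _ ≤ K * C ^ K * (m + K) ^ a := by
      gcongr <;> omega

/-! ### 5. Regime arithmetic -/

/-- `(L+1)² ≤ 2^L` for `L ≥ 6`. [folklore] -/
theorem succ_sq_le_two_pow (L : ℕ) (hL : 6 ≤ L) : (L + 1) ^ 2 ≤ 2 ^ L := by
  induction L, hL using Nat.le_induction with
  | base => norm_num
  | succ L hL ih =>
    have h1 : 2 * L + 3 ≤ (L + 1) ^ 2 := by nlinarith
    calc (L + 1 + 1) ^ 2 = (L + 1) ^ 2 + (2 * L + 3) := by ring
      _ ≤ 2 ^ L + 2 ^ L := Nat.add_le_add ih (h1.trans ih)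
      _ = 2 ^ (L + 1) := by ring

/-- In the quasi-polynomial regime `m ≤ 2^(c(log₂K+1)²)`, for all `K ≥ K₀(a,c)` (with `K₀ ≥ 2`) one
has `(m+K)^a ≤ K^K`. [folklore] -/
theorem regime_pow_le (a c : ℕ) : ∃ K₀ : ℕ, 2 ≤ K₀ ∧ ∀ K ≥ K₀,
    ∀ m ≤ 2 ^ (c * (Nat.log 2 K + 1) ^ 2), (m + K) ^ a ≤ K ^ K := by
  refine ⟨2 ^ max 6 (a * (c + 2)), ?_, fun K hK m hm => ?_⟩
  · calc (2 : ℕ) = 2 ^ 1 := by norm_num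
      _ ≤ 2 ^ max 6 (a * (c + 2)) := Nat.pow_le_pow_right (by norm_num) (by omega)
  set L := Nat.log 2 K with hL
  have hK0 : K ≠ 0 := by
    have : 0 < 2 ^ max 6 (a * (c + 2)) := by positivity
    omega
  have h1 : 2 ^ L ≤ K := Nat.pow_log_le_self 2 hK0
  have h2 : K < 2 ^ (L + 1) := Nat.lt_pow_succ_log_self one_lt_two K
  have hL6 : max 6 (a * (c + 2)) ≤ L := Nat.le_log_of_pow_le one_lt_two hK
  have h6 : 6 ≤ L := le_of_max_le_left hL6
  have hac : a * (c + 2) ≤ L := le_of_max_le_right hL6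
  have hm' : m ≤ 2 ^ ((c + 1) * (L + 1) ^ 2) :=
    hm.trans (Nat.pow_le_pow_right (by norm_num) (by nlinarith))
  have hK' : K ≤ 2 ^ ((c + 1) * (L + 1) ^ 2) :=
    h2.le.trans (Nat.pow_le_pow_right (by norm_num) (by nlinarith))
  have h3 : m + K ≤ 2 ^ ((c + 2) * (L + 1) ^ 2) := by
    calc m + K ≤ 2 ^ ((c + 1) * (L + 1) ^ 2) + 2 ^ ((c + 1) * (L + 1) ^ 2) := Nat.add_le_add hm' hK'
      _ = 2 ^ ((c + 1) * (L + 1) ^ 2 + 1) := by ring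
      _ ≤ 2 ^ ((c + 2) * (L + 1) ^ 2) := Nat.pow_le_pow_right (by norm_num) (by nlinarith)
  have h4 : a * ((c + 2) * (L + 1) ^ 2) ≤ L * 2 ^ L := by
    calc a * ((c + 2) * (L + 1) ^ 2) = (a * (c + 2)) * (L + 1) ^ 2 := by ring
      _ ≤ L * 2 ^ L := Nat.mul_le_mul hac (succ_sq_le_two_pow L h6)
  calc (m + K) ^ a ≤ (2 ^ ((c + 2) * (L + 1) ^ 2)) ^ a := Nat.pow_le_pow_left h3 a
    _ = 2 ^ (a * ((c + 2) * (L + 1) ^ 2)) := by rw [← pow_mul, mul_comm]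
    _ ≤ 2 ^ (L * 2 ^ L) := Nat.pow_le_pow_right (by norm_num) h4
    _ = (2 ^ L) ^ (2 ^ L) := by rw [pow_mul]
    _ ≤ K ^ (2 ^ L) := Nat.pow_le_pow_left h1 _
    _ ≤ K ^ K := Nat.pow_le_pow_right (Nat.pos_of_ne_zero hK0) h1

/-! ### 6. The item -/

/-- Settles `stmt-ValiantsHypothesis-18503` (`RolleToDescartes`, route `SymmetroidDescartes`):
the inductive step `DerivedPencilRolle` (matrix Rolle against the derived pencil, constants `C, a`)
implies the lacunary matrix Descartes rule `LacunaryDescartes` with `b := max C 1 + 2` — iterate the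
step down to one term, merge equal exponents, perturb the coefficients off their spectra, count roots
between consecutive test points, and absorb `K·C'^K·(m+K)^a` into `K^(bK)` in the regime
`m ≤ 2^(c(log₂K+1)²)`. [folklore] -/
theorem rolleToDescartes_proof :
    Summit.ValiantsHypothesis.ValiantsHypothesis.Theses.SymmetroidDescartes.RolleToDescartes := by
  unfold Summit.ValiantsHypothesis.ValiantsHypothesis.Theses.SymmetroidDescartes.RolleToDescartes
  intro hRolle
  obtain ⟨C, a, hC, hA⟩ := alternations_le_of_derivedPencilRolle hRolle
  unfold Summit.ValiantsHypothesis.ValiantsHypothesis.Theses.SymmetroidDescartes.LacunaryDescartes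
  refine ⟨C + 2, fun c => ?_⟩
  obtain ⟨K₀, hK₀2, hK₀⟩ := regime_pow_le a c
  refine ⟨K₀, fun K hK m hm S d hS N τ hτ hpos halt => ?_⟩
  have hK2 : 2 ≤ K := hK₀2.trans hK
  have hKK : K ≠ 0 := by omega
  have hCK : C ^ K ≤ K ^ (C * K) :=
    calc C ^ K ≤ (K ^ C) ^ K :=
          Nat.pow_le_pow_left (C.lt_two_pow_self.le.trans (Nat.pow_le_pow_left hK2 C)) K
      _ = K ^ (C * K) := by rw [← pow_mul]
  calc N ≤ K * C ^ K * (m + K) ^ a := hA K m S d hS N τ hτ hpos halt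
    _ ≤ K ^ K * K ^ (C * K) * K ^ K :=
        Nat.mul_le_mul (Nat.mul_le_mul (Nat.le_self_pow hKK K) hCK) (hK₀ K hK m hm)
    _ = K ^ ((C + 2) * K) := by rw [← pow_add, ← pow_add]; ring

end Summit.ValiantsHypothesis.ValiantsHypothesis.Theorems.SymmetroidDescartes
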